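import Literature.NumberTheory.GaloisRepresentations.LubinTateColemanRelativeProductTwo
import Literature.NumberTheory.GaloisRepresentations.LubinTateUnramifiedRelativeGalois
import Literature.NumberTheory.GaloisRepresentations.LubinTateTowerRelNorm
import HarnessLib

/-!
# De Shalit's (2) over an unramified base (`q = 2`): the relative norm of `G^ι(ω)` from `E·K_π^{m+1}` down to
# `E·K_π^{m+1-k}` is `(𝒩_E^{(k)} G)^ι([π^k]ω)` — values of `𝒩_E`-iterates are relative norms along the tower

De Shalit, *Iwasawa theory of elliptic curves with complex multiplication* (1987), Ch. I §2.2, proof of the Theorem,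
formula (2), in the RELATIVE situation `k' = E ⊇ F = k` unramified (finite, normal, `E ⊆ F^{nr}`), for the
Lubin–Tate group of `f = πX + X²` of `F` (`|𝓀_F| = 2`, so `W_f^1 = {0, −π}` is `F`-rational and the Coleman
operator `𝒩_E = relNormTwo` has coefficients in `𝒪_E`, no descent): for `G ∈ 𝒪_E⟦X⟧`, a primitive point
`ω = [u]λ'` of `E·K_π^{m+1}` (`λ' = ι λ_{m+1}`) and `k ≤ m`,

  `∏_{σ ∈ Gal(E·K_π^{m+1}/E), σ[π^k]ω = [π^k]ω} σ(G^ι(ω)) = (𝒩_E^{(k)} G)^ι([π^k]ω)`,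

the product being the norm from `E·K_π^{m+1}` to `E·K_π^{m+1-k} = E([π^k]ω)`.  PROVED (0 sorry), from the product
formula `(𝒩_E^{(k)}G)([π^k]y) = ∏_{α ∈ W_f^k} G(y [+] α)` (`LubinTateColemanRelativeProductTwo`) and the
parametrisation of the stabiliser by `𝓀^k` (`LubinTateUnramifiedRelativeGalois`):

* `relAct_add`, `relAct_pow_eq`, `inclPt_relCohPt` (`ι ω_{n+1} = [π^{m-n}] ω_{m+1}`), `inclUnitBall_evS_map`
  (`ι(G^ι(y)) = G^ι(ι y)`).
* ★★ `prod_relStab_algEquiv_evS` — **de Shalit's (2) over `𝒪_E`** (displayed formula).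
* `prod_relStab_algEquiv_evS_cohPt` — the same at the coherent generator `ω_{m+1} = cohPt`, `[π^{m-n}]ω_{m+1} = ι ω_{n+1}`:
  `∏_{σ|_E = id, σ ω_{n+1} = ω_{n+1}} σ(G^ι(ω_{m+1})) = ι((𝒩_E^{(m-n)} G)^ι(ω_{n+1}))`.
* ★ `prod_relStab_algEquiv_evS_of_relNormTwo_eq_map` — **if `𝒩_E G = G^ψ` then the norm of `G^ι(ω_{m+1})` down to
  `E·K_π^{n+1}` is `((ψ^{m-n} G)^ι)(ω_{n+1})`** (Cor. 2.3 (ii) read backwards: the values of a twisted-invariant series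
  along `(ψ^{-(m+1)})` are norm-coherent).
* `algebraMap_towerNorm_sup_eq_prod_relStab` — the honest relative norm `N_{E·K_π^{m+1}/E·K_π^{n+1}}` (Mathlib
  `Algebra.norm` for the tower algebra) IS this stabiliser product (`E` Galois over `F`).

## References

* E. de Shalit, *Iwasawa theory of elliptic curves with complex multiplication* (1987), Ch. I §2.2 (2), Cor. 2.3 (ii). [deShalit1987]
* R. Coleman, *Division values in local fields*, Invent. Math. 53 (1979), Thm. A, Cor. 14.

## Tree reuse

`evS_ltSMul_pow_relNormTwo_iterate`, `relNormTwo_iterate_map_inclUnitBall`, `relNormTwo_iterate_map`,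
`algEquiv_evS_map_inclUnitBall`, `LubinTate.map_evS` (`LubinTateColemanRelativeProductTwo`); `relStabParam`,
`mapPt_relStabParam(_pow)`, `relStabParam_injective`, `exists_relStabParam_eq`, `forall_apply_inclusion_sup_iff`,
`isGalois_sup_ltField` (`LubinTateUnramifiedRelativeGalois`); `algebraMap_towerNorm_eq_prod` (`LubinTateTowerRelNorm`).
-/

noncomputable section

open scoped PowerSeries.WithPiTopology

namespace Literature.NumberTheory.GaloisRepresentations

section RelativeNormCoherentTwo

open GaloisRepresentations.IsNonarchimedeanLocalField LubinTate ValuativeRel Field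

variable (F : Type*) [Field F] [ValuativeRel F] [TopologicalSpace F] [IsNonarchimedeanLocalField F]

attribute [local instance] ltNormUniformSpace ltNormIsUniformAddGroup rk1 nF nE fintypeResidueField

variable {F}
variable {π : 𝒪[F]} (hπ : (valuation F).IsUniformizer (π : F))
variable (E : IntermediateField F (AlgebraicClosure F)) [FiniteDimensional F E] (m : ℕ)

/-! ### Small supplements on `[a]_f` in `E·K_π^{m+1}` -/

/-- `[a + b] x = [a] x [+] [b] x`. [cite: LubinTate1965, §1 Thm. 1 (9)] -/
theorem relAct_add (a b : 𝒪[F])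
    (x : (maxNilIdeal F (E ⊔ ltField π m : IntermediateField F (AlgebraicClosure F))).toIdeal) :
    relAct hπ E m (a + b) x =
      ltAdd (maxNilIdeal F (E ⊔ ltField π m : IntermediateField F (AlgebraicClosure F))) (isLTRing_LTCoeff hπ)
        (isLTSeries_LTCoeff π) (relAct hπ E m a x) (relAct hπ E m b x) := by
  rw [relAct, map_add]; exact add_ltSMul _ _ _ _ _ x

/-- `[a^k] x = [a]^k x` in the `LTCoeff`-form used by the product formula. [cite: LubinTate1965, §1 Thm. 1 (9)] -/
theorem relAct_pow_eq (a : 𝒪[F]) (k : ℕ)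
    (x : (maxNilIdeal F (E ⊔ ltField π m : IntermediateField F (AlgebraicClosure F))).toIdeal) :
    relAct hπ E m (a ^ k) x =
      ltSMul (maxNilIdeal F (E ⊔ ltField π m : IntermediateField F (AlgebraicClosure F))) (isLTRing_LTCoeff hπ)
        (isLTSeries_LTCoeff π) (LTCoeff.of F a ^ k) x := by
  rw [relAct, map_pow]

/-- **`ι ω_{n+1} = [π^{m-n}] ω_{m+1}`** in `E·K_π^{m+1}` for the coherent generator `ω_{·} = cohPt` (`n ≤ m`).
[cite: deShalit1987, Ch. I §2.2] -/
theorem inclPt_relCohPt {n : ℕ} (hnm : n ≤ m) :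
    inclPt (sup_le_sup_left (ltField_mono hπ hnm) E)
        (inclPt (le_sup_right : ltField π n ≤ E ⊔ ltField π n) (cohPt hπ n)) =
      relAct hπ E m (π ^ (m - n)) (inclPt (le_sup_right : ltField π m ≤ E ⊔ ltField π m) (cohPt hπ m)) := by
  refine pt_ext ?_
  rw [coe_inclPt, coe_inclPt, relAct, ← inclPt_ltAct_eq_ltSMul hπ le_sup_right, ltAct_pow_sub_cohPt hπ hnm, coe_inclPt,
    coe_inclPt]

/-- `ω_{m+1} = [u_m] λ'` in `E·K_π^{m+1}`. [cite: deShalit1987, Ch. I §2.2] -/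
theorem inclPt_cohPt_eq_relAct :
    inclPt (le_sup_right : ltField π m ≤ E ⊔ ltField π m) (cohPt hπ m) =
      relAct hπ E m (cohUnit hπ m : 𝒪[F]) (relGenPt hπ E m) := by
  rw [cohPt_eq, inclPt_ltAct_genPt]

/-- **`ι(G^{ι₁}(y)) = G^{ι₂}(ι y)`**: evaluation of `𝒪_E`-series commutes with the inclusions `E·K_π^{n+1} ≤ E·K_π^{m+1}`.
[cite: deShalit1987, Ch. I §2.2] -/
theorem inclUnitBall_evS_map {E₁ E₂ : IntermediateField F (AlgebraicClosure F)} [FiniteDimensional F E₁]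
    [FiniteDimensional F E₂] (h₁ : E ≤ E₁) (h₂ : E ≤ E₂) (h : E₁ ≤ E₂) (G : PowerSeries (unitBall E))
    (y : (maxNilIdeal F E₁).toIdeal) :
    inclUnitBall h (evS (maxNilIdeal F E₁) y (PowerSeries.map (inclUnitBall (F := F) h₁ : unitBall E →+* unitBall E₁) G)) =
      evS (maxNilIdeal F E₂) (inclPt h y) (PowerSeries.map (inclUnitBall (F := F) h₂ : unitBall E →+* unitBall E₂) G) := by
  have e := map_evS (maxNilIdeal F E₁) (maxNilIdeal F E₂) (inclUnitBall (F := F) h : unitBall E₁ →+* unitBall E₂)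
    (continuous_inclUnitBall h) y (inclPt h y).2 (PowerSeries.map (inclUnitBall (F := F) h₁ : unitBall E →+* unitBall E₁) G)
  have hcomp : (inclUnitBall (F := F) h : unitBall E₁ →+* unitBall E₂).comp
      (inclUnitBall (F := F) h₁ : unitBall E →+* unitBall E₁) = (inclUnitBall (F := F) h₂ : unitBall E →+* unitBall E₂) :=
    RingHom.ext fun c => Subtype.ext (Subtype.ext rfl)
  rw [← RingHom.comp_apply (PowerSeries.map _) (PowerSeries.map _), ← PowerSeries.map_comp, hcomp] at e
  exact e

/-! ### De Shalit's (2) over `𝒪_E` -/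

variable [Normal F E] (hE : E ≤ maxUnramified F) (hq : residueFieldCard F = 2) (u : 𝒪[F]ˣ) {k : ℕ}

include hE

open scoped Classical in
/-- ★★ **De Shalit's (2), relative form over an unramified base (`q = 2`)**: for `G ∈ 𝒪_E⟦X⟧`, a primitive point
`ω = [u]λ'` of `E·K_π^{m+1}` and `k ≤ m`,
`∏_{σ ∈ Aut_F(E·K_π^{m+1}), σ|_E = id, σ[π^k]ω = [π^k]ω} σ(G^ι(ω)) = (𝒩_E^{(k)} G)^ι([π^k] ω)` — the norm of `G^ι(ω)` from
`E·K_π^{m+1}` to `E([π^k]ω) = E·K_π^{m+1-k}` is the value of the `k`-th iterate of Coleman's relative norm operator.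
[cite: deShalit1987, Ch. I §2.2 (2)] -/
theorem prod_relStab_algEquiv_evS (hk : k ≤ m) (G : PowerSeries (unitBall E)) :
    ∏ σ ∈ Finset.univ.filter (fun σ : (E ⊔ ltField π m : IntermediateField F (AlgebraicClosure F)) ≃ₐ[F]
        (E ⊔ ltField π m : IntermediateField F (AlgebraicClosure F)) =>
        (∀ x : E, σ (IntermediateField.inclusion le_sup_left x) = IntermediateField.inclusion le_sup_left x) ∧
          mapPt σ (relAct hπ E m (π ^ k) (relAct hπ E m (u : 𝒪[F]) (relGenPt hπ E m))) =
            relAct hπ E m (π ^ k) (relAct hπ E m (u : 𝒪[F]) (relGenPt hπ E m))),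
      σ ((evS (maxNilIdeal F (E ⊔ ltField π m : IntermediateField F (AlgebraicClosure F)))
          (relAct hπ E m (u : 𝒪[F]) (relGenPt hπ E m))
          (PowerSeries.map (inclUnitBall (F := F) (le_sup_left : E ≤ E ⊔ ltField π m) :
            unitBall E →+* unitBall (E ⊔ ltField π m : IntermediateField F (AlgebraicClosure F))) G) :
          unitBall (E ⊔ ltField π m : IntermediateField F (AlgebraicClosure F))) :
          (E ⊔ ltField π m : IntermediateField F (AlgebraicClosure F))) =
      ((evS (maxNilIdeal F (E ⊔ ltField π m : IntermediateField F (AlgebraicClosure F)))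
          (relAct hπ E m (π ^ k) (relAct hπ E m (u : 𝒪[F]) (relGenPt hπ E m)))
          (PowerSeries.map (inclUnitBall (F := F) (le_sup_left : E ≤ E ⊔ ltField π m) :
            unitBall E →+* unitBall (E ⊔ ltField π m : IntermediateField F (AlgebraicClosure F)))
            ((relNormTwo hπ E hq)^[k] G)) :
          unitBall (E ⊔ ltField π m : IntermediateField F (AlgebraicClosure F))) :
          (E ⊔ ltField π m : IntermediateField F (AlgebraicClosure F))) := by
  classical
  -- right-hand side: the Coleman product over `W_f^k`
  rw [← relNormTwo_iterate_map_inclUnitBall hπ hq (le_sup_left : E ≤ E ⊔ ltField π m) k G, relAct_pow_eq,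
    evS_ltSMul_pow_relNormTwo_iterate hπ hq (le_sup_right : ltField π m ≤ E ⊔ ltField π m) k (by omega)]
  simp_rw [inclPt_ltAct_genPt, ← relAct_add]
  rw [SubmonoidClass.coe_finsetProd]
  -- left-hand side: reparametrise the stabiliser by `e ↦ σ_e`
  symm
  refine Finset.prod_bij (fun e _ => relStabParam hπ E m hE u hk e) (fun e _ => ?_) (fun e₁ _ e₂ _ h12 => ?_)
    (fun σ hσ => ?_) (fun e _ => ?_)
  · rw [Finset.mem_filter]
    exact ⟨Finset.mem_univ _, relStabParam_apply_inclusion hπ E m hE u hk e, mapPt_relStabParam_pow hπ E m hE u hk e⟩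
  · exact relStabParam_injective hπ E m hE u hk h12
  · rw [Finset.mem_filter] at hσ
    obtain ⟨e, he⟩ := exists_relStabParam_eq hπ E m hE u hk hσ.2.1 hσ.2.2
    exact ⟨e, Finset.mem_univ _, he⟩
  · rw [algEquiv_evS_map_inclUnitBall (le_sup_left : E ≤ E ⊔ ltField π m) _ (relStabParam_apply_inclusion hπ E m hE u hk e),
      mapPt_relStabParam]

open scoped Classical in
/-- **De Shalit's (2) at the coherent generator**: with `ω_{m+1} = cohPt` (so `[π^{m-n}] ω_{m+1} = ι ω_{n+1}`), for `n ≤ m`,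
`∏_{σ|_E = id, σ(ι ω_{n+1}) = ι ω_{n+1}} σ(G^ι(ω_{m+1})) = ι((𝒩_E^{(m-n)} G)^ι(ω_{n+1}))` — the norm of `G^ι(ω_{m+1})` from
`E·K_π^{m+1}` down to `E·K_π^{n+1}`. [cite: deShalit1987, Ch. I §2.2 (2)] -/
theorem prod_relStab_algEquiv_evS_cohPt {n : ℕ} (hnm : n ≤ m) (G : PowerSeries (unitBall E)) :
    ∏ σ ∈ Finset.univ.filter (fun σ : (E ⊔ ltField π m : IntermediateField F (AlgebraicClosure F)) ≃ₐ[F]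
        (E ⊔ ltField π m : IntermediateField F (AlgebraicClosure F)) =>
        (∀ x : E, σ (IntermediateField.inclusion le_sup_left x) = IntermediateField.inclusion le_sup_left x) ∧
          mapPt σ (inclPt (sup_le_sup_left (ltField_mono hπ hnm) E)
              (inclPt (le_sup_right : ltField π n ≤ E ⊔ ltField π n) (cohPt hπ n))) =
            inclPt (sup_le_sup_left (ltField_mono hπ hnm) E)
              (inclPt (le_sup_right : ltField π n ≤ E ⊔ ltField π n) (cohPt hπ n))),
      σ ((evS (maxNilIdeal F (E ⊔ ltField π m : IntermediateField F (AlgebraicClosure F)))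
          (inclPt (le_sup_right : ltField π m ≤ E ⊔ ltField π m) (cohPt hπ m))
          (PowerSeries.map (inclUnitBall (F := F) (le_sup_left : E ≤ E ⊔ ltField π m) :
            unitBall E →+* unitBall (E ⊔ ltField π m : IntermediateField F (AlgebraicClosure F))) G) :
          unitBall (E ⊔ ltField π m : IntermediateField F (AlgebraicClosure F))) :
          (E ⊔ ltField π m : IntermediateField F (AlgebraicClosure F))) =
      ((inclUnitBall (sup_le_sup_left (ltField_mono hπ hnm) E)
          (evS (maxNilIdeal F (E ⊔ ltField π n : IntermediateField F (AlgebraicClosure F)))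
            (inclPt (le_sup_right : ltField π n ≤ E ⊔ ltField π n) (cohPt hπ n))
            (PowerSeries.map (inclUnitBall (F := F) (le_sup_left : E ≤ E ⊔ ltField π n) :
              unitBall E →+* unitBall (E ⊔ ltField π n : IntermediateField F (AlgebraicClosure F)))
              ((relNormTwo hπ E hq)^[m - n] G))) :
          unitBall (E ⊔ ltField π m : IntermediateField F (AlgebraicClosure F))) :
          (E ⊔ ltField π m : IntermediateField F (AlgebraicClosure F))) := by
  rw [inclUnitBall_evS_map E le_sup_left le_sup_left, inclPt_relCohPt hπ E m hnm, inclPt_cohPt_eq_relAct,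
    ← prod_relStab_algEquiv_evS hπ E m hE hq (cohUnit hπ m) (by omega : m - n ≤ m) G]

omit [Normal F E] hE in
/-- **Iterating a twisted invariance**: if `𝒩_E G = G^ψ` for a ring endomorphism `ψ` of `𝒪_E` fixing `π`, then
`𝒩_E^{(k)} G = G^{ψ^k}`. [cite: deShalit1987, Ch. I §2.3 (ii)] -/
theorem relNormTwo_iterate_eq_map_iterate {ψ : unitBall E →+* unitBall E}
    (hψ : ψ (algebraMap 𝒪[F] (unitBall E) π) = algebraMap 𝒪[F] (unitBall E) π) {G : PowerSeries (unitBall E)}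
    (hG : relNormTwo hπ E hq G = PowerSeries.map ψ G) (k : ℕ) :
    (relNormTwo hπ E hq)^[k] G = (PowerSeries.map ψ)^[k] G := by
  induction k with
  | zero => rfl
  | succ k ih =>
    rw [Function.iterate_succ_apply, hG, relNormTwo_iterate_map hπ hq hψ, ih,
      ← Function.iterate_succ_apply' (PowerSeries.map ψ)]

open scoped Classical in
/-- ★ **Norm-coherence of the values of a twisted-invariant series** (de Shalit I §2.2 (2) with Cor. 2.3 (ii), relative
form): if `𝒩_E G = G^ψ` (`ψ` fixing `π`, e.g. the Frobenius of `𝒪_E`) then for `n ≤ m` the norm of `G^ι(ω_{m+1})` from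
`E·K_π^{m+1}` to `E·K_π^{n+1}` is `ι((ψ^{m-n} G)^ι(ω_{n+1}))`.  Applied to `ψ^{-(m+1)} G` this says that
`m ↦ (ψ^{-(m+1)} G)^ι(ω_{m+1})` is a norm-coherent sequence. [cite: deShalit1987, Ch. I §2.3 (ii)] -/
theorem prod_relStab_algEquiv_evS_of_relNormTwo_eq_map {n : ℕ} (hnm : n ≤ m) {ψ : unitBall E →+* unitBall E}
    (hψ : ψ (algebraMap 𝒪[F] (unitBall E) π) = algebraMap 𝒪[F] (unitBall E) π) {G : PowerSeries (unitBall E)}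
    (hG : relNormTwo hπ E hq G = PowerSeries.map ψ G) :
    ∏ σ ∈ Finset.univ.filter (fun σ : (E ⊔ ltField π m : IntermediateField F (AlgebraicClosure F)) ≃ₐ[F]
        (E ⊔ ltField π m : IntermediateField F (AlgebraicClosure F)) =>
        (∀ x : E, σ (IntermediateField.inclusion le_sup_left x) = IntermediateField.inclusion le_sup_left x) ∧
          mapPt σ (inclPt (sup_le_sup_left (ltField_mono hπ hnm) E)
              (inclPt (le_sup_right : ltField π n ≤ E ⊔ ltField π n) (cohPt hπ n))) =
            inclPt (sup_le_sup_left (ltField_mono hπ hnm) E)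
              (inclPt (le_sup_right : ltField π n ≤ E ⊔ ltField π n) (cohPt hπ n))),
      σ ((evS (maxNilIdeal F (E ⊔ ltField π m : IntermediateField F (AlgebraicClosure F)))
          (inclPt (le_sup_right : ltField π m ≤ E ⊔ ltField π m) (cohPt hπ m))
          (PowerSeries.map (inclUnitBall (F := F) (le_sup_left : E ≤ E ⊔ ltField π m) :
            unitBall E →+* unitBall (E ⊔ ltField π m : IntermediateField F (AlgebraicClosure F))) G) :
          unitBall (E ⊔ ltField π m : IntermediateField F (AlgebraicClosure F))) :
          (E ⊔ ltField π m : IntermediateField F (AlgebraicClosure F))) =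
      ((inclUnitBall (sup_le_sup_left (ltField_mono hπ hnm) E)
          (evS (maxNilIdeal F (E ⊔ ltField π n : IntermediateField F (AlgebraicClosure F)))
            (inclPt (le_sup_right : ltField π n ≤ E ⊔ ltField π n) (cohPt hπ n))
            (PowerSeries.map (inclUnitBall (F := F) (le_sup_left : E ≤ E ⊔ ltField π n) :
              unitBall E →+* unitBall (E ⊔ ltField π n : IntermediateField F (AlgebraicClosure F)))
              ((PowerSeries.map ψ)^[m - n] G))) :
          unitBall (E ⊔ ltField π m : IntermediateField F (AlgebraicClosure F))) :
          (E ⊔ ltField π m : IntermediateField F (AlgebraicClosure F))) := by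
  rw [prod_relStab_algEquiv_evS_cohPt hπ E m hE hq hnm G, relNormTwo_iterate_eq_map_iterate hπ E hq hψ hG]

/-! ### The stabiliser product IS the relative norm -/

omit [Normal F E] hE in
open scoped Classical in
/-- **The relative norm `N_{E·K_π^{m+1}/E·K_π^{n+1}}` as the stabiliser product** (`E` Galois over `F`, `n ≤ m`):
`ι(N(x)) = ∏_{σ ∈ Aut_F(E·K_π^{m+1}), σ|_E = id, σ(ι ω_{n+1}) = ι ω_{n+1}} σ x` (Mathlib's `Algebra.norm` for the tower algebra
`E·K_π^{n+1} → E·K_π^{m+1}`). [cite: deShalit1987, Ch. I §2.2] -/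
theorem algebraMap_towerNorm_sup_eq_prod_relStab [IsGalois F E] {n : ℕ} (hnm : n ≤ m)
    (x : (E ⊔ ltField π m : IntermediateField F (AlgebraicClosure F))) :
    IntermediateField.inclusion (sup_le_sup_left (ltField_mono hπ hnm) E)
        (@Algebra.norm (E ⊔ ltField π n : IntermediateField F (AlgebraicClosure F))
          (E ⊔ ltField π m : IntermediateField F (AlgebraicClosure F)) _ _
          (towerAlgebra (sup_le_sup_left (ltField_mono hπ hnm) E)) x) =
      ∏ σ ∈ Finset.univ.filter (fun σ : (E ⊔ ltField π m : IntermediateField F (AlgebraicClosure F)) ≃ₐ[F]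
        (E ⊔ ltField π m : IntermediateField F (AlgebraicClosure F)) =>
        (∀ x : E, σ (IntermediateField.inclusion le_sup_left x) = IntermediateField.inclusion le_sup_left x) ∧
          mapPt σ (inclPt (sup_le_sup_left (ltField_mono hπ hnm) E)
              (inclPt (le_sup_right : ltField π n ≤ E ⊔ ltField π n) (cohPt hπ n))) =
            inclPt (sup_le_sup_left (ltField_mono hπ hnm) E)
              (inclPt (le_sup_right : ltField π n ≤ E ⊔ ltField π n) (cohPt hπ n))), σ x := by
  classical
  haveI := isGalois_sup_ltField hπ E m
  rw [algebraMap_towerNorm_eq_prod]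
  refine Finset.prod_congr (Finset.filter_congr fun σ _ => ?_) fun _ _ => rfl
  rw [forall_apply_inclusion_sup_iff hπ E m hnm σ]
  -- `σ` fixes `ι λ_{n+1}` iff it fixes `ι ω_{n+1} = [u_n] ι λ_{n+1}` (given that it fixes `E`)
  refine and_congr_right fun _ => ?_
  have hω : inclPt (sup_le_sup_left (ltField_mono hπ hnm) E)
      (inclPt (le_sup_right : ltField π n ≤ E ⊔ ltField π n) (cohPt hπ n)) =
      relAct hπ E m (cohUnit hπ n : 𝒪[F]) (inclPt (sup_le_sup_left (ltField_mono hπ hnm) E) (relGenPt hπ E n)) := by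
    rw [inclPt_cohPt_eq_relAct]
    exact Subtype.ext (inclUnitBall_ltSMul _ (LTCoeff.of F (cohUnit hπ n : 𝒪[F])) (relGenPt hπ E n))
  have hlam : inclPt (sup_le_sup_left (ltField_mono hπ hnm) E) (relGenPt hπ E n) =
      relAct hπ E m ((cohUnit hπ n)⁻¹ : 𝒪[F]ˣ) (inclPt (sup_le_sup_left (ltField_mono hπ hnm) E)
        (inclPt (le_sup_right : ltField π n ≤ E ⊔ ltField π n) (cohPt hπ n))) := by
    rw [hω, ← relAct_mul, Units.inv_mul, relAct_one]
  constructor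
  · intro h; rw [hω, mapPt_relAct', h]
  · intro h; rw [hlam, mapPt_relAct', h]

end RelativeNormCoherentTwo

end Literature.NumberTheory.GaloisRepresentations
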